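import Summits.AtomisticToContinuum.BoseEinsteinCondensation.Theses.BECParticleIncrement
import Summits.AtomisticToContinuum.BoseEinsteinCondensation.Theorems.BECParticleIncrementStepInduction

/-!
# Route `BECParticleIncrement`, assembly item `Assembly` (stmt-AtomisticToContinuum-12325)

Settles the assembly item `stmt-AtomisticToContinuum-12325` of route
`route-AtomisticToContinuum-BECParticleIncrement`:

  `GPWindowIncrement → ScatteringLengthFinite → StaticResponseBound → BootstrapStep →
    BoseEinsteinCondensation`.

Proof (pure composition, as planned by the route): `ScatteringLengthFinite` is by definition the
finiteness hypothesis `∀ v, IsRepulsiveFiniteRange v → scatteringLength v ≠ ⊤` of `StepInduction`,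
so the landed glue `becParticleIncrement_stepInduction_proof : StepInduction`
(`Theorems/BECParticleIncrementStepInduction.lean`, item stmt-AtomisticToContinuum-12324) turns the
four hypotheses into `IncrementBound`, and the route's deciding theorem
`Theses.BECParticleIncrement.closes : IncrementBound → BoseEinsteinCondensation` (telescoping the
per-particle increment from `M = 0` inside the final box `L = (N/ρ)^{1/3}`, sorry-free in the route
file) concludes.

References: [LSSY2005, Ch. 5] (the setting: Dirichlet-box ground states of the dilute Bose gas and
the condensate number `λ_max`); the statement itself is route-internal glue [folklore].
-/

namespace Summit.AtomisticToContinuum.BoseEinsteinCondensation.Theorems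

open Literature.MathematicalPhysics.QuantumManyBody.BoseGas
open Summit.AtomisticToContinuum.BoseEinsteinCondensation.Theses.BECParticleIncrement

/-- **Item stmt-AtomisticToContinuum-12325** (`Assembly` of route `BECParticleIncrement`, exact
route decl): the Gross–Pitaevskii-window increment, finiteness of the scattering length, the
static-response bound and the bulk-regime bootstrap step together imply ground-state
Bose–Einstein condensation — by the glue `StepInduction` (strong induction on the particle number
in a fixed Dirichlet box, giving `IncrementBound`) followed by the route's deciding theorem
`closes` (telescoping inside the final box). [folklore] -/
theorem becParticleIncrement_assembly_proof :
    Summit.AtomisticToContinuum.BoseEinsteinCondensation.Theses.BECParticleIncrement.Assembly := by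
  unfold Theses.BECParticleIncrement.Assembly
  intro hG hA hS hB
  exact Theses.BECParticleIncrement.closes
    (becParticleIncrement_stepInduction_proof hG hA hS hB)

end Summit.AtomisticToContinuum.BoseEinsteinCondensation.Theorems
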